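import Summits.CriticalPhenomena.CardyFormulaZ2.Theorems.CardyIKTransportIKLinearTransportStubTriLawOfEmpty
import Summits.CriticalPhenomena.CardyFormulaZ2.Theorems.CardyIKTransportIKLinearTransportStubCouplingToLimitsEvents
import Literature.Probability.Percolation.TriThetaHalf
import Literature.Probability.Percolation.CornerPercolation
import Summits.CriticalPhenomena.CardyFormulaZ2.Theorems.CardyIKTransportIKMixedBoxCrossingDefs

/-!
# Stub `stub_honeycombRSW` of the line `paired-mirror-exploration` (crux `IKMixedBoxCrossing`,
# stmt-CriticalPhenomena-5911)

`PatternLocality → HoneycombRSW`: a box none of whose cell columns is an `S`-column is crossed the long way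
with probability bounded below uniformly.  Route:

1. `PatternLocality` with `S' := ∅` (the pattern `a + i ∉ S`, `i < w`, is `HcCols S a w`) replaces `S` by `∅`;
2. DICTIONARY (`obs_empty_mem_lrCross_iff`, `obs_empty_mem_tbCross_iff`): for `S = ∅` every face carries the
   anti-diagonal, the cell triangulation `cellGraph univ` IS the triangular lattice `triGraph`
   (`cellGraph_univ_adj_iff`), and an open crossing of `blackEdges (B, univ)` inside the box is a `𝕋`-path of
   black cells of the lattice parallelogram `triStrip` (`mem_openConnIn_iff_pathIn`), i.e. the events
   `triHCross` / `triVCross` of `TriRSWChaining.lean` read on `blackSet ∅`;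
3. LAW (`stub_TriLawOfEmpty`): `blackSet ∅` pushes `μIK` to `sitePercolation (Site 2) half`, so
   `pLR ∅ a b (m+2) (k+1) = triLRCrossingProb half (m+1) k` and
   `pTB ∅ a b (m+1) (k+2) = triLRCrossingProb half (k+1) m`;
4. RSW on `𝕋` (`tri_rsw_half_holds` at aspect ratio `3`, `triLRCrossingProb_anti_width`, and
   `triLRCrossingProb_pos` for the `1 × 2` box): `∃ c > 0, ∀ k, c ≤ triLRCrossingProb half (2k+1) k`.
-/

noncomputable section

namespace Summit.CriticalPhenomena.CardyFormulaZ2.Cruxes.IKMixedBoxCrossing.PairedMirrorExploration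

open scoped Classical
open MeasureTheory
open Literature.Probability.Percolation Literature.Probability.LatticeModels
open Summit.CriticalPhenomena.CardyFormulaZ2.Theorems.IKLinearTransport.PinnedDiagramExchange
  (Ω μIK parSet blackSet antiSet Obs obs νmix blackEdges lrCross tbCross stub_TriLawOfEmpty)
open Summit.CriticalPhenomena.CardyFormulaZ2.Theorems.IKLinearTransport.PinnedDiagramExchange.CouplingToLimits
  (adj_of_mk_mem_blackEdges mk_mem_blackEdges_of_adj)

namespace HoneycombStub

/-! ## The `S = ∅` member: every face is anti-diagonal, the triangulation is `𝕋` -/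

/-- For the empty pattern every face carries the anti-diagonal. -/
theorem antiSet_empty (ω : Ω) : antiSet (∅ : Set ℤ) ω = Set.univ := by
  ext f
  simp [antiSet]

/-- The observable configuration of the `S = ∅` member is `(blackSet ∅ ω, univ)`. -/
theorem obs_empty (ω : Ω) : obs (∅ : Set ℤ) ω = (blackSet ∅ ω, Set.univ) := by
  rw [obs, antiSet_empty]

/-- With every face anti-diagonal, the cell triangulation is the triangular lattice `𝕋 = ℤ² + (1,-1)`
(`cellGraph` of the gauge vocabulary, written qualified: `LatticeModels.cellGraph` is another graph). -/
theorem cellGraph_univ_adj_iff (u v : Site 2) :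
    (Theorems.IKLinearTransport.PinnedDiagramExchange.cellGraph Set.univ).Adj u v ↔ triGraph.Adj u v := by
  rw [triGraph_adj_iff_coord]
  simp only [Theorems.IKLinearTransport.PinnedDiagramExchange.cellGraph, SimpleGraph.fromRel_adj,
    Set.mem_univ, not_true_eq_false, and_false, false_or, and_true, ne_eq, Site.eq_iff_two, Pi.add_apply,
    Matrix.cons_val_zero, Matrix.cons_val_one]
  omega

/-- DICTIONARY, path level: an open path of `blackEdges (B, univ)` inside `X` between two distinct cells is
a `𝕋`-path of black cells of `X`, and conversely. -/
theorem mem_openConnIn_iff_pathIn {B X : Set (Site 2)} {x y : Site 2} (hxy : x ≠ y) :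
    blackEdges (B, Set.univ) ∈ openConnIn X x y ↔ PathIn triGraph (X ∩ B) x y := by
  constructor
  · rintro ⟨hx, hy, hr⟩
    rw [SimpleGraph.reachable_iff_reflTransGen] at hr
    suffices key : ∀ d : X,
        Relation.ReflTransGen ((openGraph (blackEdges (B, Set.univ))).induce X).Adj ⟨x, hx⟩ d →
          x = d.1 ∨ PathIn triGraph (X ∩ B) x d.1 by
      rcases key ⟨y, hy⟩ hr with h | h
      · exact absurd h hxy
      · exact h
    intro d hd
    induction hd with
    | refl => exact Or.inl rfl
    | @tail c d _ hcd ih =>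
      simp only [SimpleGraph.comap_adj, Function.Embedding.coe_subtype, openGraph_adj] at hcd
      obtain ⟨hadj, hcB, hdB⟩ := adj_of_mk_mem_blackEdges hcd.1
      have hadj' : triGraph.Adj c.1 d.1 := (cellGraph_univ_adj_iff _ _).1 hadj
      rcases ih with h | h
      · subst h
        exact Or.inr (PathIn.of_adj ⟨c.2, hcB⟩ ⟨d.2, hdB⟩ hadj')
      · exact Or.inr (h.tail hadj' ⟨d.2, hdB⟩)
  · rintro ⟨hxXB, hr⟩
    clear hxy
    induction hr with
    | refl => exact ⟨hxXB.1, hxXB.1, SimpleGraph.Reachable.refl _⟩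
    | @tail b c hab hbc ih =>
      obtain ⟨hx, hb, hreach⟩ := ih
      have hbB : b ∈ B := (PathIn.right_mem (G := triGraph) ⟨hxXB, hab⟩).2
      have hedge : s(b, c) ∈ blackEdges (B, Set.univ) :=
        mk_mem_blackEdges_of_adj (x := (B, Set.univ)) ((cellGraph_univ_adj_iff b c).2 hbc.1) hbB hbc.2.2
      have hadj : ((openGraph (blackEdges (B, Set.univ))).induce X).Adj ⟨b, hb⟩ ⟨c, hbc.2.1⟩ :=
        (openGraph_adj _ _ _).2 ⟨hedge, hbc.1.ne⟩
      exact ⟨hx, hbc.2.1, hreach.trans hadj.reachable⟩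

/-- DICTIONARY, wide boxes: the black LR crossing of the `(m+2) × (k+1)` box at `(a, b)` of the `S = ∅` member
is the horizontal crossing `triHCross a b (m+1) k` of the lattice parallelogram `[a, a+m+1] × [b, b+k]` read on
the colours. -/
theorem obs_empty_mem_lrCross_iff (ω : Ω) (a b : ℤ) (m k : ℕ) :
    obs ∅ ω ∈ lrCross a b (m + 2) (k + 1) ↔ blackSet ∅ ω ∈ triHCross a b (m + 1) k := by
  have hbox :
      {v : Site 2 | a ≤ v 0 ∧ v 0 < a + ((m + 2 : ℕ) : ℤ) ∧ b ≤ v 1 ∧ v 1 < b + ((k + 1 : ℕ) : ℤ)} =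
        triStrip a b (m + 1) k := by
    ext v
    simp only [Set.mem_setOf_eq, mem_triStrip, Nat.cast_add, Nat.cast_ofNat, Nat.cast_one]
    omega
  rw [obs_empty]
  simp only [lrCross, triHCross, Set.mem_setOf_eq, mem_openCrossing_iff, hbox]
  constructor
  · rintro ⟨x, hx, y, hy, h⟩
    have hxy : x ≠ y := fun e => by
      have := congrFun e 0
      rw [hx.1, hy.1] at this
      push_cast at this
      omega
    exact ⟨x, y, hx.1, by rw [hy.1]; push_cast; ring, (mem_openConnIn_iff_pathIn hxy).1 h⟩
  · rintro ⟨x, y, hx, hy, h⟩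
    have hxs := (h.left_mem).1
    have hys := (h.right_mem).1
    simp only [mem_triStrip] at hxs hys
    have hxy : x ≠ y := fun e => by
      have := congrFun e 0
      rw [hx, hy] at this
      push_cast at this
      omega
    refine ⟨x, ⟨hx, hxs.2.2.1, by push_cast; omega⟩, y, ⟨by rw [hy]; push_cast; ring, hys.2.2.1,
      by push_cast; omega⟩, (mem_openConnIn_iff_pathIn hxy).2 h⟩

/-- DICTIONARY, tall boxes: the black BT crossing of the `(m+1) × (k+2)` box at `(a, b)` of the `S = ∅` member
is the vertical crossing `triVCross a b m (k+1)` of `[a, a+m] × [b, b+k+1]` read on the colours. -/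
theorem obs_empty_mem_tbCross_iff (ω : Ω) (a b : ℤ) (m k : ℕ) :
    obs ∅ ω ∈ tbCross a b (m + 1) (k + 2) ↔ blackSet ∅ ω ∈ triVCross a b m (k + 1) := by
  have hbox :
      {v : Site 2 | a ≤ v 0 ∧ v 0 < a + ((m + 1 : ℕ) : ℤ) ∧ b ≤ v 1 ∧ v 1 < b + ((k + 2 : ℕ) : ℤ)} =
        triStrip a b m (k + 1) := by
    ext v
    simp only [Set.mem_setOf_eq, mem_triStrip, Nat.cast_add, Nat.cast_ofNat, Nat.cast_one]
    omega
  rw [obs_empty]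
  simp only [tbCross, triVCross, Set.mem_setOf_eq, mem_openCrossing_iff, hbox]
  constructor
  · rintro ⟨x, hx, y, hy, h⟩
    have hxy : x ≠ y := fun e => by
      have := congrFun e 1
      rw [hx.1, hy.1] at this
      push_cast at this
      omega
    exact ⟨x, y, hx.1, by rw [hy.1]; push_cast; ring, (mem_openConnIn_iff_pathIn hxy).1 h⟩
  · rintro ⟨x, y, hx, hy, h⟩
    have hxs := (h.left_mem).1
    have hys := (h.right_mem).1
    simp only [mem_triStrip] at hxs hys
    have hxy : x ≠ y := fun e => by
      have := congrFun e 1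
      rw [hx, hy] at this
      push_cast at this
      omega
    refine ⟨x, ⟨hx, hxs.1, by push_cast; omega⟩, y, ⟨by rw [hy]; push_cast; ring, hys.1,
      by push_cast; omega⟩, (mem_openConnIn_iff_pathIn hxy).2 h⟩

/-! ## The law of the `S = ∅` member and the crossing probabilities -/

/-- Horizontal crossings of lattice parallelograms are measurable events. -/
theorem measurableSet_triHCross (a b : ℤ) (m n : ℕ) : MeasurableSet (triHCross a b m n) := by
  have h := measurableSet_shift_triLRCrossing ![a, b] m n
  rw [← triHCross_eq_preimage_shift] at h
  simpa using h

/-- Vertical crossings of lattice parallelograms are measurable events. -/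
theorem measurableSet_triVCross (a b : ℤ) (m n : ℕ) : MeasurableSet (triVCross a b m n) := by
  have h := measurableSet_shift_triTBCrossing ![a, b] m n
  rw [← triVCross_eq_preimage_shift] at h
  simpa using h

/-- `P_∅[LR((m+2) × (k+1))] = P_{1/2}(LR_𝕋(m+1, k))`. -/
theorem pLR_empty (a b : ℤ) (m k : ℕ) : pLR ∅ a b (m + 2) (k + 1) = triLRCrossingProb half (m + 1) k := by
  have hset : obs ∅ ⁻¹' lrCross a b (m + 2) (k + 1) = blackSet ∅ ⁻¹' triHCross a b (m + 1) k :=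
    Set.ext fun ω => obs_empty_mem_lrCross_iff ω a b m k
  rw [pLR, hset, ← map_measureReal_apply stub_TriLawOfEmpty.1 (measurableSet_triHCross a b _ _),
    stub_TriLawOfEmpty.2]
  exact triSitePercolation_real_triHCross half a b (m + 1) k

/-- `P_∅[BT((m+1) × (k+2))] = P_{1/2}(LR_𝕋(k+1, m))`. -/
theorem pTB_empty (a b : ℤ) (m k : ℕ) : pTB ∅ a b (m + 1) (k + 2) = triLRCrossingProb half (k + 1) m := by
  have hset : obs ∅ ⁻¹' tbCross a b (m + 1) (k + 2) = blackSet ∅ ⁻¹' triVCross a b m (k + 1) :=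
    Set.ext fun ω => obs_empty_mem_tbCross_iff ω a b m k
  rw [pTB, hset, ← map_measureReal_apply stub_TriLawOfEmpty.1 (measurableSet_triVCross a b _ _),
    stub_TriLawOfEmpty.2]
  exact triSitePercolation_real_triVCross half a b m (k + 1)

/-! ## RSW on `𝕋` for the parallelograms `[0, 2k+1] × [0, k]` -/

/-- `∃ c > 0, ∀ k, c ≤ P_{1/2}(LR_𝕋(2k+1, k))`: `tri_rsw_half_holds` at aspect ratio `3` and width
antitonicity (`2k+1 ≤ 3k` for `k ≥ 1`), and positivity for `k = 0`. -/
theorem exists_rsw_const : ∃ c : ℝ, 0 < c ∧ ∀ k : ℕ, c ≤ triLRCrossingProb half (2 * k + 1) k := by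
  obtain ⟨c, hc, h⟩ := tri_rsw_half_holds 3 (by norm_num)
  have hhalf : 0 < ((half : unitInterval) : ℝ) := by simp [half]
  refine ⟨min c (triLRCrossingProb half 1 0), lt_min hc (triLRCrossingProb_pos hhalf 1 0), fun k => ?_⟩
  rcases Nat.eq_zero_or_pos k with rfl | hk
  · exact min_le_right _ _
  · have hfloor : ⌊(3 : ℝ) * (k : ℕ)⌋₊ = 3 * k := by
      rw [show (3 : ℝ) * (k : ℕ) = ((3 * k : ℕ) : ℝ) by push_cast; ring, Nat.floor_natCast]
    have h1 := (h k (by rw [hfloor]; omega)).1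
    rw [hfloor] at h1
    exact (min_le_left _ _).trans (h1.trans (triLRCrossingProb_anti_width half (by omega) k))

end HoneycombStub

/-- STUB `stub_honeycombRSW` · HONEYCOMB-PURE BOXES are crossed the long way, uniformly in the pattern:
if no cell column of the `2n × n` (resp. `n × 2n`) box is an `S`-column then, by `PatternLocality`, its
crossing probability is that of the `S = ∅` member, i.e. (law of the empty pattern + dictionary) the
`P_{1/2}`-probability of a `𝕋`-crossing of the parallelogram `[0, 2n-1] × [0, n-1]`, bounded below by RSW
on `𝕋` (`tri_rsw_half_holds`). -/
theorem stub_honeycombRSW : PatternLocality → HoneycombRSW := by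
  intro hloc
  obtain ⟨c, hc, hk⟩ := HoneycombStub.exists_rsw_const
  refine ⟨c, hc, fun S n a b hn => ?_⟩
  obtain ⟨k, rfl⟩ : ∃ k, n = k + 1 := ⟨n - 1, by omega⟩
  have hpat : ∀ w : ℕ, HcCols S a w → ∀ i : ℕ, i < w → (a + i ∈ S ↔ a + i ∈ (∅ : Set ℤ)) :=
    fun w hS i hi => by
      simp only [Set.mem_empty_iff_false, iff_false]
      exact hS _ (by omega) (by omega)
  constructor
  · intro hS
    rw [(hloc S ∅ a a b b (2 * (k + 1)) (k + 1) (hpat _ hS)).1, show 2 * (k + 1) = 2 * k + 2 by ring,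
      HoneycombStub.pLR_empty]
    exact hk k
  · intro hS
    rw [(hloc S ∅ a a b b (k + 1) (2 * (k + 1)) (hpat _ hS)).2, show 2 * (k + 1) = 2 * k + 2 by ring,
      HoneycombStub.pTB_empty]
    exact hk k

end Summit.CriticalPhenomena.CardyFormulaZ2.Cruxes.IKMixedBoxCrossing.PairedMirrorExploration

end
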